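import Summits.BirchSwinnertonDyer.BirchSwinnertonDyer.Theorems.SignedLowerHalvesSmallImageLowerHalfBothSignsLambdaLowerThreeNsThetaPartnerArithmeticHalfExport
import Summits.BirchSwinnertonDyer.BirchSwinnertonDyer.Theorems.SignedLowerHalvesSmallImageLowerHalfBothSignsRttOneSidedCruxExistsPartner
import HarnessLib

/-!
# Route `SignedLowerHalves`, crux L `SmallImageLowerHalfBothSigns` (item stmt-BirchSwinnertonDyer-23599), line `rtt_w3` —
# the engine stated ON THE THETA PARTNER WITH ITS GRÖSSENCHARAKTER (PSB_θψ): socket with coefficients, glue to the v6 ∃-stub, and crux L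
# BY NAME from print ∧ floor ∧ Kan₂ ∧ PSB_θψ (a v7 composition target)

LEAD `cruxlead-stmt-BirchSwinnertonDyer-23599` g3; helper `--supports stmt-BirchSwinnertonDyer-23599`; THEOREMS ONLY, no `sorry`; closes nothing;
BSD is not proved by any of this.

WHAT. (1) `heckeThetaPartner_withCoeff_of_arithmeticHalf` — the socket `heckeThetaPartner_of_arithmeticHalf` (…ThetaPartnerOdd, Ribet's
weight-two CM newform `g = θ_ψ` on `Γ₀(M)`, `M ∣ |d_K|·N𝔪`) re-run with ONE more conjunct exported: `ι(a_ℓ(g)) = e⁻¹(Σ_{Nw=ℓ} ψ(w))` at every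
prime `ℓ ∤ |d_K|·N𝔪` (it was used internally for the congruence and then forgotten). (2) `existsPartnerSelmerBoundT3_ns_of_psbTheta` — the v6
registered engine stub `stub_existsPartnerSelmerBoundT3_ns` (∃-form) FOLLOWS from PSB_θψ := «the partner Selmer bound for the theta partner
`g = θ_ψ` of every EXPORTED arithmetic half `(K, σ, 𝔪, ψ, e)` + small-image datum `(Φ, k, e₀)`» by K0₂′ (`exists_arithmeticHalf_classwide`,
…ThetaPartnerArithmeticHalfExport) and (1). PSB_θψ is the shape the road of record proves (census `Lines/rtt_w3-CENSUS-PSB-g3.md`: E1 Shapiro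
transport `W ↔ ψ̄` consumes `(Φ, k, U ≤ G_K, ρ̄(G_K) ⊆ kˣ)`; E2 the signed main conjecture of `ψ` at the inert `p`; E3 the coefficient relation).
(3) ★ `smallImageLowerHalfBothSigns_of_oneSignFloor_of_psbTheta` — crux L BY NAME from the twelve cited facts, the floor, Kan₂ and PSB_θψ.

References: [Ribet1977Nebentypus] §3 Thm. (3.4), Cor. (3.5); [Serre1972] §2.2, §4.2 c), §5.2 (iv); [Kobayashi2003] Conjecture (p. 2), Thm. 7.4;
[PollackWeston2011MT] §3.1, Thm. 4.1; [GreenbergVatsal2000] Prop. (2.4); [Pollack2003] Prop. 6.18; [KimPark2017] §2.2, Thm. 3.19; [Rubin1991] Thm. 4.1.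
-/

set_option autoImplicit false
-- D-0017: single-problem summit, the namespace repeats the problem name by design.
set_option linter.dupNamespace false
noncomputable section

open scoped Classical MatrixGroups ModularForm BigOperators NumberField

open CongruenceSubgroup WeierstrassCurve Field Polynomial NumberField IsDedekindDomain Matrix
  Literature.NumberTheory.EllipticCurves Literature.NumberTheory.EllipticCurves.ModularForms
  Literature.NumberTheory.EllipticCurves.Rank1Residual
  Literature.NumberTheory.EllipticCurves.Kobayashi2003
  Literature.NumberTheory.EllipticCurves.GreenbergVatsal2000 ZpExtension
  Literature.NumberTheory.IwasawaTheory Rat.HeightOneSpectrum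
  Literature.NumberTheory.GaloisRepresentations Literature.NumberTheory.LFunctions
  Literature.NumberTheory.GaloisRepresentations.HeckeCharacter Literature.NumberTheory.Automorphic
  Summit.BirchSwinnertonDyer.Rank1Residual Summit.BirchSwinnertonDyer.Rank1Residual.Supersingular
  Summit.BirchSwinnertonDyer.Rank1Residual.X1.MuLambda
  Summit.BirchSwinnertonDyer.Rank1Residual.X2.EulerFactorInvariants
  Summit.BirchSwinnertonDyer.BirchSwinnertonDyer.Theorems.SmallImageLambdaLowerThreeNsThetaTransport
  Summit.BirchSwinnertonDyer.BirchSwinnertonDyer.Theorems.HeckeThetaPartner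

/-! ## §1 The socket with the coefficient relation exported -/

namespace Summit.BirchSwinnertonDyer.BirchSwinnertonDyer.Theorems.SmallImageLambdaLowerThreeNsThetaPartner

/-- **The `p`-adic Hecke theta partner from its arithmetic half, WITH the coefficient relation** `ι(a_ℓ(g)) = e⁻¹(Σ_{Nw=ℓ} ψ(w))` off
`|d_K|·N𝔪` exported (otherwise = `heckeThetaPartner_of_arithmeticHalf` VERBATIM: Ribet's `g`, `ι = e⁻¹|_{K_g}`, a cohomological plus period,
`a_p(g) = 0` from «no ideal of norm `p`»). [cite: Ribet1977Nebentypus, §3, Thm. (3.4) and Cor. (3.5) (LNM 601, pp. 34–35)] [cite: PollackWeston2011MT, Def. 2.1] -/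
theorem heckeThetaPartner_withCoeff_of_arithmeticHalf (W : WeierstrassCurve ℚ) [W.IsElliptic] [W.IsGloballyMinimal]
    (p : ℕ) [Fact p.Prime] (k : Type) [Field k] [NumberField k] (hk2 : Module.finrank ℚ k = 2)
    (htc : IsTotallyComplex k) (σ : k →+* ℂ) (𝔪 : Ideal (𝓞 k)) (h𝔪 : 𝔪 ≠ ⊥)
    (ψ : HeightOneSpectrum (𝓞 k) → ℂ) (e : PadicAlgCl p ≃+* ℂ)
    (hnop : ∀ I : Ideal (𝓞 k), Ideal.absNorm I ≠ p)
    (hpD : ¬ p ∣ (discr k).natAbs * Ideal.absNorm 𝔪)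
    (hbad : ∀ (ℓ : ℕ) [Fact ℓ.Prime], ℓ ∣ (discr k).natAbs * Ideal.absNorm 𝔪 → ¬ W.HasGoodReductionAtPrime ℓ)
    (hψG : IsGrossencharakter 𝔪 (embType σ) (embTypeConj σ) ψ)
    (hneb : ∀ n : ℕ, Odd n → n.Coprime ((discr k).natAbs * Ideal.absNorm 𝔪) →
      idealPow k ψ (Ideal.span {(n : 𝓞 k)}) = (jacobiSym (discr k) n : ℂ) * (n : ℂ) ^ (2 - 1))
    (htrace : ∀ (ℓ : ℕ) [Fact ℓ.Prime], ℓ ≠ p → W.HasGoodReductionAtPrime ℓ →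
      ‖e.symm (∑ᶠ (w : HeightOneSpectrum (𝓞 k)) (_ : Ideal.absNorm w.asIdeal = ℓ), ψ w) -
        (W.frobeniusTrace ℓ : PadicAlgCl p)‖ < 1) :
    ∃ (M : ℕ) (_ : NeZero M) (g : CuspForm (CongruenceSubgroup.Gamma0 M) 2)
      (ι : coeffField g →+* PadicAlgCl p) (Ω : ℂ),
      M ∣ (discr k).natAbs * Ideal.absNorm 𝔪 ∧ ¬ p ∣ M ∧ IsNewform0 g ∧ IsCMForm (liftToGamma1 M 2 g) ∧
        cuspCoeff g p = 0 ∧ IsCohomologicalPlusPeriod g ι Ω ∧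
        (∀ ℓ : ℕ, ℓ.Prime → ¬ ℓ ∣ p * M * W.conductorNorm ℤ →
          ‖embCoeff g ι ℓ - (W.frobeniusTrace ℓ : PadicAlgCl p)‖ < 1) ∧
        (∀ ℓ : ℕ, ℓ.Prime → ¬ ℓ ∣ (discr k).natAbs * Ideal.absNorm 𝔪 →
          embCoeff g ι ℓ = e.symm (∑ᶠ (w : HeightOneSpectrum (𝓞 k)) (_ : Ideal.absNorm w.asIdeal = ℓ), ψ w)) := by
  classical
  haveI := htc
  obtain ⟨N, hN, g, hNdvd, hnew, hcmf, hcoeff⟩ :=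
    HeckeTheta.ribet_cmNewform_gamma0_two k hk2 htc σ 𝔪 h𝔪 ψ hψG (fun n hn hcop => hneb n hn hcop)
  -- `p ∤ N`
  have hpN : ¬ p ∣ N := fun h => hpD (h.trans hNdvd)
  -- the embedding `ι = e⁻¹|_{K_g}` and a cohomological period
  let ι : coeffField g →+* PadicAlgCl p := ((e.symm : ℂ ≃+* PadicAlgCl p) : ℂ →+* PadicAlgCl p).comp
    (algebraMap (coeffField g) ℂ)
  have hι : ∀ n : ℕ, embCoeff g ι n = e.symm (cuspCoeff g n) := fun n => rfl
  obtain ⟨Ω, hΩ⟩ := CohomologicalPeriod.exists_isCohomologicalPlusPeriod hnew ι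
  -- `a_p(g) = 0`: there is no prime of norm `p`
  have hap : cuspCoeff g p = 0 := by
    rw [hcoeff p Fact.out hpD]
    have hS : {v : HeightOneSpectrum (𝓞 k) | Ideal.absNorm v.asIdeal = p} = ∅ := by
      ext v; simp [hnop v.asIdeal]
    change ∑ᶠ v ∈ {v : HeightOneSpectrum (𝓞 k) | Ideal.absNorm v.asIdeal = p}, ψ v = 0
    rw [hS, finsum_mem_empty]
  refine ⟨N, hN, g, ι, Ω, hNdvd, hpN, hnew, hcmf, hap, hΩ, fun ℓ hℓ hℓdvd => ?_, fun ℓ hℓ hℓD => by rw [hι, hcoeff ℓ hℓ hℓD]⟩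
  -- the congruence at `ℓ ∤ p N N_W`
  haveI : Fact ℓ.Prime := ⟨hℓ⟩
  have hℓp : ℓ ≠ p := by
    rintro rfl; exact hℓdvd (dvd_mul_of_dvd_left (dvd_mul_right ℓ N) _)
  have hℓNW : ¬ ℓ ∣ W.conductorNorm ℤ := fun h => hℓdvd (dvd_mul_of_dvd_right h _)
  have hgood : W.HasGoodReductionAtPrime ℓ := by
    by_contra hb
    exact hℓNW ((W.dvd_conductorNorm_iff_not_hasGoodReductionAtPrime ℓ).mpr hb)
  have hℓD : ¬ ℓ ∣ (discr k).natAbs * Ideal.absNorm 𝔪 := fun h => hbad ℓ h hgood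
  rw [hι, hcoeff ℓ hℓ hℓD]
  exact htrace ℓ hℓp hgood

end Summit.BirchSwinnertonDyer.BirchSwinnertonDyer.Theorems.SmallImageLambdaLowerThreeNsThetaPartner

/-! ## §2 The v6 ∃-stub from PSB on the theta partner with its character; §3 ★ crux L BY NAME from PSB_θψ -/

namespace Summit.BirchSwinnertonDyer.BirchSwinnertonDyer.Theorems.SmallImageRttOneSided

/-- **The v6 registered engine stub (∃-form) from PSB_θψ.** If the partner Selmer bound holds for the theta partner `g = θ_ψ` (socket output,
with `ι(a_ℓ(g)) = e⁻¹(Σ_{Nw=ℓ}ψ(w))`) of every exported arithmetic half `(K, σ, 𝔪, ψ, e)` with its small-image datum `(Φ, k, e₀)` of a tier-T3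
pair, then `stub_existsPartnerSelmerBoundT3_ns` holds — by K0₂′ `exists_arithmeticHalf_classwide` and `heckeThetaPartner_withCoeff_of_arithmeticHalf`.
[cite: Serre1972, §4.2 c), §5.2 (iv)] [cite: Ribet1977Nebentypus, §3 Thm. 3.6] -/
theorem existsPartnerSelmerBoundT3_ns_of_psbTheta
    (hPSBθ : ∀ (W : WeierstrassCurve ℚ) [W.IsElliptic] [W.IsGloballyMinimal] (p : ℕ) [Fact p.Prime],
      p ≠ 2 → ClassX7 W p → ¬ W.HasCM → W.frobeniusTrace p = 0 → ¬ Surj W p →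
      ¬ (∃ (A : WeierstrassCurve ℚ) (_ : A.IsElliptic) (_ : A.IsGloballyMinimal),
        A.HasCM ∧ GoodSS A p ∧ A.frobeniusTrace p = 0 ∧
          ∃ e : geomTorsion W (p : ℤ) ≃+ geomTorsion A (p : ℤ),
            ∀ (σ : absoluteGaloisGroup ℚ) (P : geomTorsion W (p : ℤ)), e (σ • P) = σ • e P) →
      ¬ (∃ (A : WeierstrassCurve ℚ) (_ : A.IsElliptic) (_ : A.IsGloballyMinimal) (t : ℚ),
        A.HasGoodReductionAtPrime p ∧ A.frobeniusTrace p = 0 ∧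
          (∃ e : geomTorsion W (p : ℤ) ≃+ geomTorsion A (p : ℤ),
            ∀ (σ : absoluteGaloisGroup ℚ) (P : geomTorsion W (p : ℤ)), e (σ • P) = σ • e P) ∧
          A.entireLFunction 1 / (A.realPeriodRat : ℂ) = ((t : ℚ) : ℂ) ∧ t ≠ 0 ∧ padicValRat p t = 0) →
      ∀ (ε : ℤˣ) (K : Type) [Field K] [NumberField K] (σK : K →+* ℂ) (𝔪 : Ideal (𝓞 K))
        (ψ : HeightOneSpectrum (𝓞 K) → ℂ) (e : PadicAlgCl p ≃+* ℂ),
        Module.finrank ℚ K = 2 → IsTotallyComplex K → 𝔪 ≠ ⊥ →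
        (∀ I : Ideal (𝓞 K), Ideal.absNorm I ≠ p) → ¬ p ∣ (NumberField.discr K).natAbs * Ideal.absNorm 𝔪 →
        (∀ (ℓ : ℕ) [Fact ℓ.Prime], ℓ ∣ (NumberField.discr K).natAbs * Ideal.absNorm 𝔪 → ¬ W.HasGoodReductionAtPrime ℓ) →
        IsGrossencharakter 𝔪 (embType σK) (embTypeConj σK) ψ →
        (∀ n : ℕ, Odd n → n.Coprime ((NumberField.discr K).natAbs * Ideal.absNorm 𝔪) →
          idealPow K ψ (Ideal.span {(n : 𝓞 K)}) = (jacobiSym (NumberField.discr K) n : ℂ) * (n : ℂ) ^ (2 - 1)) →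
        (∀ (ℓ : ℕ) [Fact ℓ.Prime], ℓ ≠ p → W.HasGoodReductionAtPrime ℓ →
          ‖e.symm (∑ᶠ (w : HeightOneSpectrum (𝓞 K)) (_ : Ideal.absNorm w.asIdeal = ℓ), ψ w) -
            (W.frobeniusTrace ℓ : PadicAlgCl p)‖ < 1) →
        (∃ v : HeightOneSpectrum (𝓞 K), v.asIdeal = Ideal.span {(p : 𝓞 K)} ∧ Nat.card (𝓞 K ⧸ v.asIdeal) = p ^ 2) →
        ¬ (p : ℤ) ∣ NumberField.discr K →
      ∀ (Φ : Multiplicative (AddAut (geomTorsion W p)) ≃* GL (Fin 2) (ZMod p))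
        (k : Subalgebra (ZMod p) (Matrix (Fin 2) (Fin 2) (ZMod p))) (e₀ : geomTorsion W p ≃+ (Fin 2 → ZMod p)),
        (∀ (g : Multiplicative (AddAut (geomTorsion W p))) (x : geomTorsion W p),
          e₀ (Multiplicative.toAdd g x) = ((Φ g : GL (Fin 2) (ZMod p)) : Matrix (Fin 2) (Fin 2) (ZMod p)) *ᵥ e₀ x) →
        IsField k → Module.finrank (ZMod p) k = 2 →
        (letI : Module (ZMod p) (geomTorsion W p) := AddSubgroup.torsionBy.zmodModule
          ∀ g : Multiplicative (AddAut (geomTorsion W p)),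
            Matrix.trace ((Φ g : GL (Fin 2) (ZMod p)) : Matrix (Fin 2) (Fin 2) (ZMod p)) =
              LinearMap.trace (ZMod p) (geomTorsion W p) ((Multiplicative.toAdd g).toAddMonoidHom.toZModLinearMap p)) →
        (galoisRepTorsion W p).range.map Φ.toMonoidHom ≤
          Subgroup.normalizer (Serre1972.unitGroup k : Set (GL (Fin 2) (ZMod p))) →
        ((Serre1972.unitGroup k).comap Φ.toMonoidHom).comap (galoisRepTorsion W p) ≤
          (absGaloisRestrict ℚ K).toMonoidHom.range →
        (∀ τ : absoluteGaloisGroup K, Φ (galoisRepTorsion W p (absGaloisRestrict ℚ K τ)) ∈ Serre1972.unitGroup k) →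
      ∀ (M : ℕ) [NeZero M] (g : CuspForm (Gamma0 M) 2) (ι : coeffField g →+* PadicAlgCl p) (Ω : ℂ),
        ¬ p ∣ M → IsNewform0 g → Literature.NumberTheory.Automorphic.IsCMForm (liftToGamma1 M 2 g) →
        cuspCoeff g p = 0 → IsCohomologicalPlusPeriod g ι Ω →
        (∀ ℓ : ℕ, ℓ.Prime → ¬ ℓ ∣ p * M * W.conductorNorm ℤ →
          ‖embCoeff g ι ℓ - (W.frobeniusTrace ℓ : PadicAlgCl p)‖ < 1) →
        (∀ ℓ : ℕ, ℓ.Prime → ¬ ℓ ∣ (NumberField.discr K).natAbs * Ideal.absNorm 𝔪 →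
          embCoeff g ι ℓ = e.symm (∑ᶠ (w : HeightOneSpectrum (𝓞 K)) (_ : Ideal.absNorm w.asIdeal = ℓ), ψ w)) →
        ∀ (κ : ZpExtension ℚ p) (γ : absoluteGaloisGroup ℚ),
          κ.IsCyclotomic → κ.IsTopGenerator γ → IsCyclotomicVariable p γ →
        ∀ (S₀ : Finset (HeightOneSpectrum (𝓞 ℚ))), (∀ v ∈ S₀, ((p : ℕ) : 𝓞 ℚ) ∉ v.asIdeal) →
          (∀ v : HeightOneSpectrum (𝓞 ℚ), ¬ W.HasGoodReductionAt v → v ∈ S₀) →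
          (∀ v : HeightOneSpectrum (𝓞 ℚ), natGenerator v ∣ M → v ∈ S₀) →
        ∀ (D : SignedSelmerDualData W κ γ ε) [Module.Finite (IwasawaAlgebra p) D.X],
          Module.IsTorsion (IwasawaAlgebra p) D.X → D.mu = 0 →
        ∀ L : IwasawaAlgebraO (Set.range ι), L ≠ 0 →
          (∀ n : ℕ, (Even n ↔ ε = 1) → IsCongrModOmegaO (Set.range ι) n ((mazurTateElementK g Ω p n).map ι)
            (((((-1) ^ (n / 2 + 1) * (if ε = 1 then cyclotomicOmegaMinus p n else cyclotomicOmegaPlus p n)).map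
                (Int.castRingHom (PadicAlgCl p)) : (PadicAlgCl p)[X]) : PowerSeries (PadicAlgCl p)) *
              iwasawaOToPowerSeries (Set.range ι) L)) →
          ∃ d : ℕ, (∀ k : ℕ, ‖PowerSeries.coeff k (iwasawaOToPowerSeries (Set.range ι) L)‖ ≤
              ‖PowerSeries.coeff d (iwasawaOToPowerSeries (Set.range ι) L)‖) ∧
            (∀ k : ℕ, k < d → ‖PowerSeries.coeff k (iwasawaOToPowerSeries (Set.range ι) L)‖ <
              ‖PowerSeries.coeff d (iwasawaOToPowerSeries (Set.range ι) L)‖) ∧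
            d + ∑ v ∈ S₀, p ^ (frobeniusExponent p (natGenerator v : ℤ_[p])).valuation *
              layerLambda ((1 - C (embCoeff g ι (natGenerator v)) * X +
                (if natGenerator v ∣ M then 0 else C (natGenerator v : PadicAlgCl p)) * X ^ 2).comp
                  (C ((natGenerator v : PadicAlgCl p)⁻¹) * (X + 1))) ≤
              lambdaInvariant p D.X + ∑ v ∈ S₀, delta W p v) :
    ∀ (W : WeierstrassCurve ℚ) [W.IsElliptic] [W.IsGloballyMinimal] (p : ℕ) [Fact p.Prime],
      p ≠ 2 → ClassX7 W p → ¬ W.HasCM → W.frobeniusTrace p = 0 → ¬ Surj W p →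
      ¬ (∃ (A : WeierstrassCurve ℚ) (_ : A.IsElliptic) (_ : A.IsGloballyMinimal),
        A.HasCM ∧ GoodSS A p ∧ A.frobeniusTrace p = 0 ∧
          ∃ e : geomTorsion W (p : ℤ) ≃+ geomTorsion A (p : ℤ),
            ∀ (σ : absoluteGaloisGroup ℚ) (P : geomTorsion W (p : ℤ)), e (σ • P) = σ • e P) →
      ¬ (∃ (A : WeierstrassCurve ℚ) (_ : A.IsElliptic) (_ : A.IsGloballyMinimal) (t : ℚ),
        A.HasGoodReductionAtPrime p ∧ A.frobeniusTrace p = 0 ∧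
          (∃ e : geomTorsion W (p : ℤ) ≃+ geomTorsion A (p : ℤ),
            ∀ (σ : absoluteGaloisGroup ℚ) (P : geomTorsion W (p : ℤ)), e (σ • P) = σ • e P) ∧
          A.entireLFunction 1 / (A.realPeriodRat : ℂ) = ((t : ℚ) : ℂ) ∧ t ≠ 0 ∧ padicValRat p t = 0) →
      ∀ (ε : ℤˣ), ∃ (M : ℕ) (_ : NeZero M) (g : CuspForm (Gamma0 M) 2) (ι : coeffField g →+* PadicAlgCl p) (Ω : ℂ),
        ¬ p ∣ M ∧ IsNewform0 g ∧ Literature.NumberTheory.Automorphic.IsCMForm (liftToGamma1 M 2 g) ∧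
          cuspCoeff g p = 0 ∧ IsCohomologicalPlusPeriod g ι Ω ∧
          (∀ ℓ : ℕ, ℓ.Prime → ¬ ℓ ∣ p * M * W.conductorNorm ℤ →
            ‖embCoeff g ι ℓ - (W.frobeniusTrace ℓ : PadicAlgCl p)‖ < 1) ∧
          ∀ (κ : ZpExtension ℚ p) (γ : absoluteGaloisGroup ℚ),
            κ.IsCyclotomic → κ.IsTopGenerator γ → IsCyclotomicVariable p γ →
          ∀ (S₀ : Finset (HeightOneSpectrum (𝓞 ℚ))), (∀ v ∈ S₀, ((p : ℕ) : 𝓞 ℚ) ∉ v.asIdeal) →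
            (∀ v : HeightOneSpectrum (𝓞 ℚ), ¬ W.HasGoodReductionAt v → v ∈ S₀) →
            (∀ v : HeightOneSpectrum (𝓞 ℚ), natGenerator v ∣ M → v ∈ S₀) →
          ∀ (D : SignedSelmerDualData W κ γ ε) [Module.Finite (IwasawaAlgebra p) D.X],
            Module.IsTorsion (IwasawaAlgebra p) D.X → D.mu = 0 →
          ∀ L : IwasawaAlgebraO (Set.range ι), L ≠ 0 →
            (∀ n : ℕ, (Even n ↔ ε = 1) → IsCongrModOmegaO (Set.range ι) n ((mazurTateElementK g Ω p n).map ι)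
              (((((-1) ^ (n / 2 + 1) * (if ε = 1 then cyclotomicOmegaMinus p n else cyclotomicOmegaPlus p n)).map
                  (Int.castRingHom (PadicAlgCl p)) : (PadicAlgCl p)[X]) : PowerSeries (PadicAlgCl p)) *
                iwasawaOToPowerSeries (Set.range ι) L)) →
            ∃ d : ℕ, (∀ k : ℕ, ‖PowerSeries.coeff k (iwasawaOToPowerSeries (Set.range ι) L)‖ ≤
                ‖PowerSeries.coeff d (iwasawaOToPowerSeries (Set.range ι) L)‖) ∧
              (∀ k : ℕ, k < d → ‖PowerSeries.coeff k (iwasawaOToPowerSeries (Set.range ι) L)‖ <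
                ‖PowerSeries.coeff d (iwasawaOToPowerSeries (Set.range ι) L)‖) ∧
              d + ∑ v ∈ S₀, p ^ (frobeniusExponent p (natGenerator v : ℤ_[p])).valuation *
                layerLambda ((1 - C (embCoeff g ι (natGenerator v)) * X +
                  (if natGenerator v ∣ M then 0 else C (natGenerator v : PadicAlgCl p)) * X ^ 2).comp
                    (C ((natGenerator v : PadicAlgCl p)⁻¹) * (X + 1))) ≤
                lambdaInvariant p D.X + ∑ v ∈ S₀, delta W p v := by
  intro W _ _ p _ hp hX hcm hap hs hT1 hTu ε
  obtain ⟨K, _, _, σK, 𝔪, ψ, e, hK2, htc, h𝔪, hnop, hpD, hbad, hψG, hneb, htrace, hv, hpd, -, Φ, k, e₀, he₀, hk, h2, htr, hGN, hUle, hKU⟩ :=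
    Summit.BirchSwinnertonDyer.BirchSwinnertonDyer.Theorems.SmallImageLambdaLowerThreeNsThetaPartner.exists_arithmeticHalf_classwide W p hp hX hs
  obtain ⟨M, hM, g, ι, Ω, -, hpM, hnew, hcmf, hapg, hΩ, hcong, hcoeff⟩ :=
    Summit.BirchSwinnertonDyer.BirchSwinnertonDyer.Theorems.SmallImageLambdaLowerThreeNsThetaPartner.heckeThetaPartner_withCoeff_of_arithmeticHalf
      W p K hK2 htc σK 𝔪 h𝔪 ψ e hnop hpD (fun ℓ _ => hbad ℓ) hψG hneb (fun ℓ _ => htrace ℓ)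
  haveI := hM
  exact ⟨M, hM, g, ι, Ω, hpM, hnew, hcmf, hapg, hΩ, hcong,
    hPSBθ W p hp hX hcm hap hs hT1 hTu ε K σK 𝔪 ψ e hK2 htc h𝔪 hnop hpD (fun ℓ _ => hbad ℓ) hψG hneb (fun ℓ _ => htrace ℓ) hv hpd
      Φ k e₀ he₀ hk h2 htr hGN hUle hKU M g ι Ω hpM hnew hcmf hapg hΩ hcong hcoeff⟩

/-- ★ **Crux L `SmallImageLowerHalfBothSigns` BY NAME ⟸ print ∧ (one-sign floor at `p ≥ 5` = `stub_muOneSign_ns_ge5` VERBATIM) ∧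
Kan₂ ∧ PSB ON THE THETA PARTNER WITH ITS CHARACTER (tier T3)** — `smallImageLowerHalfBothSigns_of_oneSignFloor_of_existsPartnerPSB` (p754919) with `hEX3`
supplied by `existsPartnerSelmerBoundT3_ns_of_psbTheta` from `hPSBθ`; in `hEX3`'s words: on a pair with neither a CM-curve nor a unit curve partner, for each sign there EXISTS a congruent
`Γ₀(M)` CM partner (`p ∤ M`, `a_p(g) = 0`, cohomological plus period) satisfying the partner Selmer bound. Displayed print: `hJ h12 h41 h5 h3`
(Kobayashi, period units), `hD hC hS` (Deligne/Hida, Carayol, Saito@2 — used for the level clause of the ∃-partner), `hmod`, `hKim`, `hPR`,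
`hV`; `hfloor5`, `hKan` = the v5 stubs / landed Kan₂. `p = 3`: floor = THEOREM B; `5 ≤ p`: sign idleness on X7. A sorry-free line-shaped
decomposition; CONDITIONAL; closes nothing; crux L / BSD NOT proved. [cite: Kobayashi2003, Conjecture (p. 2), Thm. 7.4 (p. 13)]
[cite: Pollack2003, Conj. 6.3] [cite: BDKim2009, Cor. 2.13] [cite: PollackRubin2004, Theorem (p. 448)] [cite: PollackWeston2011MT, §3.1, Thm. 4.1 (1)] -/
theorem smallImageLowerHalfBothSigns_of_oneSignFloor_of_psbTheta
    (hJ : thm62_63_73_signedColemanKato_zetaJoint) (h12 : thm12_signedSelmerDual_finite_torsion)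
    (h41 : thm41_signedCharIdeal_divisibility)
    (h5 : realPeriodRat_eq_unit_mul_plusPeriod) (h3 : realPeriodRat_eq_unit_mul_plusPeriod_three)
    (hD : Hida2000_thm326_exists_galoisRep) (hC : Carayol1986_artinConductorExponent)
    (hS : ∀ (V : WeierstrassCurve ℚ) (ℓ : ℕ) [Fact ℓ.Prime],
      V.swanConductorAt_rationalTate_eq_wildConductorExponent_of_ringChar_eq_two ℓ)
    (hmod : exists_isNewformOf)
    (hKim : BDKim2009.cor213_signedLambda_add_sum_delta_eq_of_torsionIso)
    (hPR : PollackRubin2004.mainTheorem_signedCharIdeal_eq_of_cm) (hV : vatsal1999_plusSymbol_congruence)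
    (hfloor5 : ∀ (W : WeierstrassCurve ℚ) [W.IsElliptic] [W.IsGloballyMinimal] (p : ℕ) [Fact p.Prime],
      5 ≤ p → ClassX7 W p → ¬ W.HasCM → W.frobeniusTrace p = 0 → ¬ Surj W p →
      ∀ [NeZero (W.conductorNorm ℤ)] (f : CuspForm (Gamma0 (W.conductorNorm ℤ)) 2),
        IsNewformOf W f → ∃ (ε₀ : ℤˣ) (L₀ : IwasawaAlgebra p), IsSignedPAdicLFunction f p ε₀ L₀ ∧ HasUnitContent L₀)
    (hKan : ∀ (W : WeierstrassCurve ℚ) [W.IsElliptic] [W.IsGloballyMinimal] (p : ℕ) [Fact p.Prime],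
      p ≠ 2 → ClassX7 W p → ¬ W.HasCM → W.frobeniusTrace p = 0 → ¬ Surj W p →
      ∀ (ε : ℤˣ), ∀ (M : ℕ) [NeZero M] (g : CuspForm (Gamma0 M) 2) (ι : coeffField g →+* PadicAlgCl p) (Ω : ℂ),
        ¬ p ∣ M → (∀ ℓ : ℕ, ℓ.Prime → ℓ ≠ p → max 2 (padicValNat ℓ M) = max 2 (padicValNat ℓ (W.conductorNorm ℤ))) →
        IsNewform0 g → Literature.NumberTheory.Automorphic.IsCMForm (liftToGamma1 M 2 g) →
        cuspCoeff g p = 0 → IsPlusPeriod g Ω →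
        (∀ ℓ : ℕ, ℓ.Prime → ¬ ℓ ∣ p * M * W.conductorNorm ℤ →
          ‖embCoeff g ι ℓ - (W.frobeniusTrace ℓ : PadicAlgCl p)‖ < 1) →
        ∀ [NeZero (W.conductorNorm ℤ)] (f : CuspForm (Gamma0 (W.conductorNorm ℤ)) 2), IsNewformOf W f →
        ∀ (Lplus Lminus : IwasawaAlgebra p), IsPollackPair f p Lplus Lminus →
          HasUnitContent (kobayashiL ε Lplus Lminus) →
        ∀ (S₀ : Finset (HeightOneSpectrum (𝓞 ℚ))), (∀ v ∈ S₀, ((p : ℕ) : 𝓞 ℚ) ∉ v.asIdeal) →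
          (∀ v : HeightOneSpectrum (𝓞 ℚ), ¬ W.HasGoodReductionAt v → v ∈ S₀) →
          (∀ v : HeightOneSpectrum (𝓞 ℚ), natGenerator v ∣ M → v ∈ S₀) →
        ∃ n₀ : ℕ, ∀ n ≥ n₀, (Even n ↔ ε = 1) →
          layerLambda (((mazurTateElement f p n).map (algebraMap ℚ (PadicAlgCl p)) *
              ∏ v ∈ S₀, ((W.localPolynomialAt v).map (Int.castRingHom (PadicAlgCl p))).comp
                (C ((natGenerator v : PadicAlgCl p)⁻¹) *
                  (X + 1) ^ (PadicInt.toZModPow n (-(frobeniusExponent p (natGenerator v : ℤ_[p])))).val)) %ₘ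
              ((X + 1) ^ p ^ n - 1)) =
          layerLambda (((mazurTateElementK g Ω p n).map ι *
              ∏ v ∈ S₀, (1 - C (embCoeff g ι (natGenerator v)) * X +
                  (if natGenerator v ∣ M then 0 else C (natGenerator v : PadicAlgCl p)) * X ^ 2).comp
                (C ((natGenerator v : PadicAlgCl p)⁻¹) *
                  (X + 1) ^ (PadicInt.toZModPow n (-(frobeniusExponent p (natGenerator v : ℤ_[p])))).val)) %ₘ
              ((X + 1) ^ p ^ n - 1)))
    (hPSBθ : ∀ (W : WeierstrassCurve ℚ) [W.IsElliptic] [W.IsGloballyMinimal] (p : ℕ) [Fact p.Prime],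
      p ≠ 2 → ClassX7 W p → ¬ W.HasCM → W.frobeniusTrace p = 0 → ¬ Surj W p →
      ¬ (∃ (A : WeierstrassCurve ℚ) (_ : A.IsElliptic) (_ : A.IsGloballyMinimal),
        A.HasCM ∧ GoodSS A p ∧ A.frobeniusTrace p = 0 ∧
          ∃ e : geomTorsion W (p : ℤ) ≃+ geomTorsion A (p : ℤ),
            ∀ (σ : absoluteGaloisGroup ℚ) (P : geomTorsion W (p : ℤ)), e (σ • P) = σ • e P) →
      ¬ (∃ (A : WeierstrassCurve ℚ) (_ : A.IsElliptic) (_ : A.IsGloballyMinimal) (t : ℚ),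
        A.HasGoodReductionAtPrime p ∧ A.frobeniusTrace p = 0 ∧
          (∃ e : geomTorsion W (p : ℤ) ≃+ geomTorsion A (p : ℤ),
            ∀ (σ : absoluteGaloisGroup ℚ) (P : geomTorsion W (p : ℤ)), e (σ • P) = σ • e P) ∧
          A.entireLFunction 1 / (A.realPeriodRat : ℂ) = ((t : ℚ) : ℂ) ∧ t ≠ 0 ∧ padicValRat p t = 0) →
      ∀ (ε : ℤˣ) (K : Type) [Field K] [NumberField K] (σK : K →+* ℂ) (𝔪 : Ideal (𝓞 K))
        (ψ : HeightOneSpectrum (𝓞 K) → ℂ) (e : PadicAlgCl p ≃+* ℂ),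
        Module.finrank ℚ K = 2 → IsTotallyComplex K → 𝔪 ≠ ⊥ →
        (∀ I : Ideal (𝓞 K), Ideal.absNorm I ≠ p) → ¬ p ∣ (NumberField.discr K).natAbs * Ideal.absNorm 𝔪 →
        (∀ (ℓ : ℕ) [Fact ℓ.Prime], ℓ ∣ (NumberField.discr K).natAbs * Ideal.absNorm 𝔪 → ¬ W.HasGoodReductionAtPrime ℓ) →
        IsGrossencharakter 𝔪 (embType σK) (embTypeConj σK) ψ →
        (∀ n : ℕ, Odd n → n.Coprime ((NumberField.discr K).natAbs * Ideal.absNorm 𝔪) →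
          idealPow K ψ (Ideal.span {(n : 𝓞 K)}) = (jacobiSym (NumberField.discr K) n : ℂ) * (n : ℂ) ^ (2 - 1)) →
        (∀ (ℓ : ℕ) [Fact ℓ.Prime], ℓ ≠ p → W.HasGoodReductionAtPrime ℓ →
          ‖e.symm (∑ᶠ (w : HeightOneSpectrum (𝓞 K)) (_ : Ideal.absNorm w.asIdeal = ℓ), ψ w) -
            (W.frobeniusTrace ℓ : PadicAlgCl p)‖ < 1) →
        (∃ v : HeightOneSpectrum (𝓞 K), v.asIdeal = Ideal.span {(p : 𝓞 K)} ∧ Nat.card (𝓞 K ⧸ v.asIdeal) = p ^ 2) →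
        ¬ (p : ℤ) ∣ NumberField.discr K →
      ∀ (Φ : Multiplicative (AddAut (geomTorsion W p)) ≃* GL (Fin 2) (ZMod p))
        (k : Subalgebra (ZMod p) (Matrix (Fin 2) (Fin 2) (ZMod p))) (e₀ : geomTorsion W p ≃+ (Fin 2 → ZMod p)),
        (∀ (g : Multiplicative (AddAut (geomTorsion W p))) (x : geomTorsion W p),
          e₀ (Multiplicative.toAdd g x) = ((Φ g : GL (Fin 2) (ZMod p)) : Matrix (Fin 2) (Fin 2) (ZMod p)) *ᵥ e₀ x) →
        IsField k → Module.finrank (ZMod p) k = 2 →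
        (letI : Module (ZMod p) (geomTorsion W p) := AddSubgroup.torsionBy.zmodModule
          ∀ g : Multiplicative (AddAut (geomTorsion W p)),
            Matrix.trace ((Φ g : GL (Fin 2) (ZMod p)) : Matrix (Fin 2) (Fin 2) (ZMod p)) =
              LinearMap.trace (ZMod p) (geomTorsion W p) ((Multiplicative.toAdd g).toAddMonoidHom.toZModLinearMap p)) →
        (galoisRepTorsion W p).range.map Φ.toMonoidHom ≤
          Subgroup.normalizer (Serre1972.unitGroup k : Set (GL (Fin 2) (ZMod p))) →
        ((Serre1972.unitGroup k).comap Φ.toMonoidHom).comap (galoisRepTorsion W p) ≤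
          (absGaloisRestrict ℚ K).toMonoidHom.range →
        (∀ τ : absoluteGaloisGroup K, Φ (galoisRepTorsion W p (absGaloisRestrict ℚ K τ)) ∈ Serre1972.unitGroup k) →
      ∀ (M : ℕ) [NeZero M] (g : CuspForm (Gamma0 M) 2) (ι : coeffField g →+* PadicAlgCl p) (Ω : ℂ),
        ¬ p ∣ M → IsNewform0 g → Literature.NumberTheory.Automorphic.IsCMForm (liftToGamma1 M 2 g) →
        cuspCoeff g p = 0 → IsCohomologicalPlusPeriod g ι Ω →
        (∀ ℓ : ℕ, ℓ.Prime → ¬ ℓ ∣ p * M * W.conductorNorm ℤ →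
          ‖embCoeff g ι ℓ - (W.frobeniusTrace ℓ : PadicAlgCl p)‖ < 1) →
        (∀ ℓ : ℕ, ℓ.Prime → ¬ ℓ ∣ (NumberField.discr K).natAbs * Ideal.absNorm 𝔪 →
          embCoeff g ι ℓ = e.symm (∑ᶠ (w : HeightOneSpectrum (𝓞 K)) (_ : Ideal.absNorm w.asIdeal = ℓ), ψ w)) →
        ∀ (κ : ZpExtension ℚ p) (γ : absoluteGaloisGroup ℚ),
          κ.IsCyclotomic → κ.IsTopGenerator γ → IsCyclotomicVariable p γ →
        ∀ (S₀ : Finset (HeightOneSpectrum (𝓞 ℚ))), (∀ v ∈ S₀, ((p : ℕ) : 𝓞 ℚ) ∉ v.asIdeal) →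
          (∀ v : HeightOneSpectrum (𝓞 ℚ), ¬ W.HasGoodReductionAt v → v ∈ S₀) →
          (∀ v : HeightOneSpectrum (𝓞 ℚ), natGenerator v ∣ M → v ∈ S₀) →
        ∀ (D : SignedSelmerDualData W κ γ ε) [Module.Finite (IwasawaAlgebra p) D.X],
          Module.IsTorsion (IwasawaAlgebra p) D.X → D.mu = 0 →
        ∀ L : IwasawaAlgebraO (Set.range ι), L ≠ 0 →
          (∀ n : ℕ, (Even n ↔ ε = 1) → IsCongrModOmegaO (Set.range ι) n ((mazurTateElementK g Ω p n).map ι)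
            (((((-1) ^ (n / 2 + 1) * (if ε = 1 then cyclotomicOmegaMinus p n else cyclotomicOmegaPlus p n)).map
                (Int.castRingHom (PadicAlgCl p)) : (PadicAlgCl p)[X]) : PowerSeries (PadicAlgCl p)) *
              iwasawaOToPowerSeries (Set.range ι) L)) →
          ∃ d : ℕ, (∀ k : ℕ, ‖PowerSeries.coeff k (iwasawaOToPowerSeries (Set.range ι) L)‖ ≤
              ‖PowerSeries.coeff d (iwasawaOToPowerSeries (Set.range ι) L)‖) ∧
            (∀ k : ℕ, k < d → ‖PowerSeries.coeff k (iwasawaOToPowerSeries (Set.range ι) L)‖ <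
              ‖PowerSeries.coeff d (iwasawaOToPowerSeries (Set.range ι) L)‖) ∧
            d + ∑ v ∈ S₀, p ^ (frobeniusExponent p (natGenerator v : ℤ_[p])).valuation *
              layerLambda ((1 - C (embCoeff g ι (natGenerator v)) * X +
                (if natGenerator v ∣ M then 0 else C (natGenerator v : PadicAlgCl p)) * X ^ 2).comp
                  (C ((natGenerator v : PadicAlgCl p)⁻¹) * (X + 1))) ≤
              lambdaInvariant p D.X + ∑ v ∈ S₀, delta W p v) :
    Summit.BirchSwinnertonDyer.BirchSwinnertonDyer.Theses.SignedLowerHalves.SmallImageLowerHalfBothSigns := by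
  intro W _ _ p _ hp2 hX hCM hap hs ε
  have hT := lamTransport_le_tiered3_of_existsPartnerPSB h12 hKim hPR hmod hD hC hS h5 h3 hV hKan
    (existsPartnerSelmerBoundT3_ns_of_psbTheta hPSBθ) W p hp2 hX hCM hap hs
  by_cases hp3 : p = 3
  · exact forall_kobayashiLowerDivisibility_three_of_lamTransport_le W p hp3 hJ h12 h41 h5 h3 hX hap hs
      (fun ε' κ γ hκ hγ hγ' _ f hf ϖ hϖ Lplus Lminus hPP hfl D _ hXt hμ G m hG ↦
        hT ε' κ γ hκ hγ hγ' f hf ϖ hϖ Lplus Lminus hPP hfl D hXt hμ G m hG) ε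
  · have hp5 : 5 ≤ p := by
      have h2 := (Fact.out : p.Prime).two_le
      by_contra h
      interval_cases p
      · exact hp2 rfl
      · exact hp3 rfl
      · exact absurd (Fact.out : Nat.Prime 4) (by decide)
    obtain ⟨ε₀, hε₀⟩ := LargeImageMuFloor.exists_sign_forall_isNewformOf (W := W)
      (fun ε f ↦ ∃ L₀ : IwasawaAlgebra p, IsSignedPAdicLFunction f p ε L₀ ∧ HasUnitContent L₀)
      (fun f hf ↦ hfloor5 W p hp5 hX hCM hap hs f hf)
    have hfl : ∀ [NeZero (W.conductorNorm ℤ)] (f : CuspForm (Gamma0 (W.conductorNorm ℤ)) 2), IsNewformOf W f →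
        ∀ Lplus Lminus : IwasawaAlgebra p, IsPollackPair f p Lplus Lminus →
          HasUnitContent (kobayashiL ε₀ Lplus Lminus) := by
      intro _ f hf Lplus Lminus hPP
      obtain ⟨L₀, hL₀, hu⟩ := hε₀ f hf
      rwa [IsSignedPAdicLFunction.unique hL₀ (hPP.isSignedPAdicLFunction_kobayashiL ε₀)] at hu
    have hMC : KobayashiMainConjecture W p ε₀ :=
      kobayashiMainConjecture_of_lamTransport_le W p hp2 (thm62_63_73_signedColemanKato_zeta_of_joint hJ) h12 h41 h5 h3
        hX.1.1 hap hs ε₀ (fun f hf Lplus Lminus hPP ↦ hfl f hf Lplus Lminus hPP)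
        (fun κ γ hκ hγ hγ' _ f hf ϖ hϖ Lplus Lminus hPP D _ hXt hμ G m hG ↦
          hT ε₀ κ γ hκ hγ hγ' f hf ϖ hϖ Lplus Lminus hPP (hfl f hf Lplus Lminus hPP) D hXt hμ G m hG)
    exact (SignDefect.X7.exists_kobayashiLowerDivisibility_iff_forall W p h12 h5 h3 hJ hp2 hX hap).mp
      ⟨ε₀, kobayashiLowerDivisibility_of_mainConjecture hMC⟩ ε


end Summit.BirchSwinnertonDyer.BirchSwinnertonDyer.Theorems.SmallImageRttOneSided

end
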